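import Literature.NumberTheory.Automorphic.AdelicGroupDataQuotientUnimodular
import Literature.NumberTheory.Automorphic.GLnQuotientSubgroupHaar
import HarnessLib

/-!
# `A_G · G(K) ≅ A_G × G(K)` and its Haar measure `da ⊗ (counting measure)`, for any datum with a
central retraction; the case `G = D^×`

Topic `NumberTheory/Automorphic`; theorems and one definition with body
(`AdelicGroupData.quotientSubgroupEquivOfRetraction`), no named fact, no instance visible to
importers.

`GLnQuotientSubgroupHaar` proves, for `GL_n`, that `H = A_G · GL_n(K)` is the topological direct
product `A_G × GL_n(K)` and that every Haar measure on `H` is `κ · (dα ⊗ counting)`. The argument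
only uses the four properties of the central retraction `θ` (continuous, valued in `A_G`, the
identity on `A_G`, trivial on `G(K)`), the discreteness and countability of `G(K)`, and Haar
uniqueness (its `isHaarMeasure_count_of_discrete` is reused); here it is carried out for an
**arbitrary adelic group datum** `𝒢` with such a `θ`
(`AdelicGroupData`, as in `AdelicGroupDataCompactMeasure`, `AdelicGroupDataQuotientUnimodular`),
and instantiated for the unit group `D^×` of a finite-dimensional `K`-algebra `D ≠ 0`
(`exists_centralRetraction_units`), the side of the Jacquet–Langlands trace-formula comparison
with compact quotient:

* `AdelicGroupData.isClosed_center'_of_centralRetraction` — `A_G = {g | θ g = g}` is closed;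
* `AdelicGroupData.quotientSubgroupEquivOfRetraction` — **`H ≃ₜ* A_G × G(K)`**,
  `h ↦ (θ h, θ(h)⁻¹ h)`, inverse `(a, γ) ↦ a γ`;
* `AdelicGroupData.exists_lintegral_quotientSubgroup_eq_mul_lintegral_tsum` — **for Haar measures
  `ρ` on `H` and `α` on `A_G` there is `κ > 0` with
  `∫_H F dρ = κ ∫_{A_G} ∑_{γ ∈ G(K)} F(a γ) dα(a)` for all measurable `F ≥ 0`** (stated without the
  equivalence: the argument of `F` is the element `a γ ∈ H`);
* `AdelicGroupData.exists_lintegral_quotientSubgroup_units_eq_mul_lintegral_tsum` — the case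
  `𝒢 = units K D`: `∫_{ℝ_{>0} · Dˣ} F dρ = κ ∫_{ℝ_{>0}} ∑_{γ ∈ Dˣ} F(a γ) dα(a)`.

This is the decomposition of the fibre measure `ρ` under which the kernel
`K_Φ(x̃, x̃H) = ∫_H Φ(x̃ h⁻¹ x̃⁻¹) dρ(h)` of `AutomorphicQuotientKernel` becomes
`κ ∫_{A_G} Σ_{γ ∈ G(K)} Φ(x̃ γ⁻¹ a⁻¹ x̃⁻¹) da` — the sum over `G(K)` that is rearranged by conjugacy
classes on the geometric side of the trace formula for the compact quotient (Gelbart (1975),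
(9.13), Remark 9.23, (10.14)). Part of the inline (D-0026) decomposition of
`Literature.NumberTheory.Automorphic.strong_multiplicity_one_quaternionUnits`.

## References

* A. Weil, *Basic Number Theory* (1967), Ch. IV §4, Thm. 5 and Cor. 2 [WeilBNT1967].
* A. Borel, *Some finiteness properties of adele groups over number fields*, Publ. Math. IHÉS 16
  (1963), §5 [Borel1963].
* S. Gelbart, *Automorphic forms on adele groups* (1975), Remark 9.23, (10.14) [Gelbart1975].
-/

noncomputable section

open MeasureTheory Measure Set Filter Topology IsDedekindDomain NumberField
open scoped ENNReal NNReal TensorProduct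

namespace Literature.NumberTheory.Automorphic

namespace AdelicGroupData

universe u

section General

variable {K : Type} [Field K] [NumberField K] (𝒢 : AdelicGroupData.{u} K)
  (θ : 𝒢.Adelic →* 𝒢.Adelic) (hθA : ∀ g, θ g ∈ 𝒢.center') (hθa : ∀ a ∈ 𝒢.center', θ a = a)
  (hθγ : ∀ γ ∈ 𝒢.arithmeticSubgroup, θ γ = 1)

include hθA hθa in
/-- **`A_G` is closed** when a continuous central retraction `θ` exists (and `G(𝔸_K)` is
Hausdorff): `A_G = {g | θ g = g}`. [folklore] -/
theorem isClosed_center'_of_centralRetraction [T2Space 𝒢.Adelic] (hθc : Continuous θ) :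
    IsClosed (𝒢.center' : Set 𝒢.Adelic) := by
  have h : (𝒢.center' : Set 𝒢.Adelic) = {g | θ g = g} := by
    ext g
    simp only [SetLike.mem_coe, Set.mem_setOf_eq]
    exact ⟨fun hg => hθa g hg, fun hg => hg ▸ hθA g⟩
  rw [h]
  exact isClosed_eq hθc continuous_id

include hθA hθa hθγ in
/-- For `h ∈ H = A_G · G(K)`, `θ(h)⁻¹ h ∈ G(K)` (`mem_quotientSubgroup_iff_of_centralRetraction`).
[folklore] -/
theorem inv_retraction_mul_mem {h : 𝒢.Adelic} (hh : h ∈ 𝒢.quotientSubgroup) :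
    (θ h)⁻¹ * h ∈ 𝒢.arithmeticSubgroup :=
  (mem_quotientSubgroup_iff_of_centralRetraction 𝒢 θ hθA hθa hθγ h).1 hh

include hθA hθa hθγ in
/-- **`H = A_G · G(K)` is the topological direct product `A_G × G(K)`** for a datum with a
continuous central retraction `θ`: `h ↦ (θ h, θ(h)⁻¹ h)` with inverse `(a, γ) ↦ a γ` is a
continuous isomorphism of topological groups (`A_G` central, `A_G ∩ G(K) = 1`, `θ` continuous).
The `GL_n` case is `GLnQuotientSubgroupHaar.quotientSubgroupEquiv`. Borel (1963), §5; Weil,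
BNT IV §4. [cite: Borel1963, §5] -/
def quotientSubgroupEquivOfRetraction (hθc : Continuous θ) :
    𝒢.quotientSubgroup ≃ₜ* 𝒢.center' × 𝒢.arithmeticSubgroup where
  toFun h := (⟨θ h, hθA h⟩, ⟨(θ h)⁻¹ * h, inv_retraction_mul_mem 𝒢 θ hθA hθa hθγ h.2⟩)
  invFun p := ⟨(p.1 : 𝒢.Adelic) * p.2,
    mul_mem (𝒢.center'_le_quotientSubgroup p.1.2) (𝒢.arithmeticSubgroup_le_quotientSubgroup p.2.2)⟩
  left_inv h := Subtype.ext (mul_inv_cancel_left _ _)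
  right_inv p := by
    obtain ⟨⟨a, ha⟩, ⟨γ, hγ⟩⟩ := p
    have hθ : θ (a * γ) = a := by rw [map_mul, hθa a ha, hθγ γ hγ, mul_one]
    refine Prod.ext (Subtype.ext hθ) (Subtype.ext ?_)
    change (θ (a * γ))⁻¹ * (a * γ) = γ
    rw [hθ, inv_mul_cancel_left]
  map_mul' h h' := by
    refine Prod.ext (Subtype.ext (map_mul _ _ _)) (Subtype.ext ?_)
    change (θ ((h : 𝒢.Adelic) * h'))⁻¹ * ((h : 𝒢.Adelic) * h') =
      (θ h)⁻¹ * h * ((θ h')⁻¹ * h')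
    rw [map_mul, mul_inv_rev]
    have hc : (θ (h' : 𝒢.Adelic))⁻¹ ∈ Subgroup.center 𝒢.Adelic :=
      Subgroup.inv_mem _ (𝒢.center'_le (hθA _))
    have hB : ∀ g : 𝒢.Adelic, g * (θ (h' : 𝒢.Adelic))⁻¹ = (θ (h' : 𝒢.Adelic))⁻¹ * g :=
      fun g => Subgroup.mem_center_iff.1 hc g
    set A := (θ (h : 𝒢.Adelic))⁻¹
    set B := (θ (h' : 𝒢.Adelic))⁻¹
    calc B * A * ((h : 𝒢.Adelic) * h')
        = A * B * ((h : 𝒢.Adelic) * h') := by rw [hB A]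
      _ = A * (B * (h : 𝒢.Adelic)) * h' := by simp only [mul_assoc]
      _ = A * ((h : 𝒢.Adelic) * B) * h' := by rw [hB]
      _ = A * h * (B * h') := by simp only [mul_assoc]
  continuous_toFun := by
    refine Continuous.prodMk ?_ ?_
    · exact (hθc.comp continuous_subtype_val).subtype_mk _
    · exact ((hθc.comp continuous_subtype_val).inv.mul continuous_subtype_val).subtype_mk _
  continuous_invFun :=
    ((continuous_subtype_val.comp continuous_fst).mul
      (continuous_subtype_val.comp continuous_snd)).subtype_mk _

/-- The inverse of `quotientSubgroupEquivOfRetraction` is multiplication `(a, γ) ↦ a γ`.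
[folklore] -/
@[simp]
theorem coe_quotientSubgroupEquivOfRetraction_symm_apply (hθc : Continuous θ)
    (p : 𝒢.center' × 𝒢.arithmeticSubgroup) :
    ((((quotientSubgroupEquivOfRetraction 𝒢 θ hθA hθa hθγ hθc).symm p) : 𝒢.quotientSubgroup) :
      𝒢.Adelic) = (p.1 : 𝒢.Adelic) * p.2 := rfl

include hθA hθa hθγ in
/-- **Every Haar measure on `H = A_G · G(K)` is a multiple of `dα ⊗ (counting measure)`.** For
an adelic group datum with `G(𝔸_K)` locally compact, second countable and Hausdorff, discrete and
countable `G(K)` and a continuous central retraction `θ`: for Haar measures `ρ` on `H` and `α` on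
`A_G` there is `κ > 0` with `∫_H F dρ = κ ∫_{A_G} ∑_{γ ∈ G(K)} F(a γ) dα(a)` for every measurable
`F ≥ 0` on `H` (Haar uniqueness on the second countable locally compact group `A_G × G(K)`,
Mathlib `isMulLeftInvariant_eq_smul`, transported along `quotientSubgroupEquivOfRetraction`;
Tonelli for the counting measure). The `GL_n` case is
`GLnQuotientSubgroupHaar.exists_lintegral_quotientSubgroup_eq_mul_lintegral_tsum`.
[cite: WeilBNT1967, Ch. IV §4 Cor. 2 of Thm. 5] -/
theorem exists_lintegral_quotientSubgroup_eq_mul_lintegral_tsum [LocallyCompactSpace 𝒢.Adelic]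
    [SecondCountableTopology 𝒢.Adelic] [T2Space 𝒢.Adelic] [MeasurableSpace 𝒢.Adelic]
    [BorelSpace 𝒢.Adelic] [Countable 𝒢.arithmeticSubgroup] (hdisc : 𝒢.IsDiscreteRational)
    (hθc : Continuous θ) (ρ : Measure 𝒢.quotientSubgroup) [ρ.IsHaarMeasure]
    (α : Measure 𝒢.center') [α.IsHaarMeasure] :
    ∃ κ : ℝ≥0, 0 < κ ∧ ∀ F : 𝒢.quotientSubgroup → ℝ≥0∞, Measurable F →
      ∫⁻ h, F h ∂ρ = κ * ∫⁻ a, ∑' γ : 𝒢.arithmeticSubgroup,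
        F ⟨(a : 𝒢.Adelic) * γ, mul_mem (𝒢.center'_le_quotientSubgroup a.2)
          (𝒢.arithmeticSubgroup_le_quotientSubgroup γ.2)⟩ ∂α := by
  haveI : DiscreteTopology 𝒢.arithmeticSubgroup := hdisc
  haveI : LocallyCompactSpace 𝒢.center' :=
    (isClosed_center'_of_centralRetraction 𝒢 θ hθA hθa hθc).isClosedEmbedding_subtypeVal
      |>.locallyCompactSpace
  haveI : SecondCountableTopology 𝒢.center' := TopologicalSpace.Subtype.secondCountableTopology _
  haveI : SecondCountableTopology 𝒢.arithmeticSubgroup :=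
    TopologicalSpace.Subtype.secondCountableTopology _
  haveI : LocallyCompactSpace 𝒢.quotientSubgroup :=
    (isClosed_quotientSubgroup_of_centralRetraction 𝒢 hdisc θ hθc hθA hθa hθγ)
      |>.isClosedEmbedding_subtypeVal.locallyCompactSpace
  haveI : SecondCountableTopology 𝒢.quotientSubgroup :=
    TopologicalSpace.Subtype.secondCountableTopology _
  haveI : BorelSpace 𝒢.arithmeticSubgroup := Subtype.borelSpace _
  haveI : MeasurableSingletonClass 𝒢.arithmeticSubgroup := inferInstance
  haveI : (count : Measure 𝒢.arithmeticSubgroup).IsHaarMeasure := isHaarMeasure_count_of_discrete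
  haveI : BorelSpace (𝒢.center' × 𝒢.arithmeticSubgroup) := Prod.borelSpace
  set e := quotientSubgroupEquivOfRetraction 𝒢 θ hθA hθa hθγ hθc with he
  set π : Measure (𝒢.center' × 𝒢.arithmeticSubgroup) := α.prod count with hπ
  haveI : π.IsHaarMeasure := by rw [hπ]; infer_instance
  set ρ' := Measure.map e ρ with hρ'
  haveI : ρ'.IsHaarMeasure := e.toMulEquiv.isHaarMeasure_map ρ e.continuous e.symm.continuous
  set κ : ℝ≥0 := ρ'.haarScalarFactor π with hκ
  have hρ'π : ρ' = κ • π := isMulLeftInvariant_eq_smul ρ' π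
  refine ⟨κ, haarScalarFactor_pos_of_isHaarMeasure ρ' π, fun F hF => ?_⟩
  set em : 𝒢.quotientSubgroup ≃ᵐ 𝒢.center' × 𝒢.arithmeticSubgroup :=
    e.toHomeomorph.toMeasurableEquiv with hem
  have hem' : (em : _ → _) = e := rfl
  have hG : Measurable fun p : 𝒢.center' × 𝒢.arithmeticSubgroup => F (e.symm p) :=
    hF.comp e.symm.continuous.measurable
  -- transport to `A_G × G(K)`
  have h1 : ∫⁻ p, F (e.symm p) ∂ρ' = ∫⁻ h, F h ∂ρ := by
    rw [hρ', ← hem', lintegral_map_equiv]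
    refine lintegral_congr fun h => ?_
    rw [hem', ContinuousMulEquiv.symm_apply_apply]
  have h2 : (fun a : 𝒢.center' => ∑' γ : 𝒢.arithmeticSubgroup,
      F ⟨(a : 𝒢.Adelic) * γ, mul_mem (𝒢.center'_le_quotientSubgroup a.2)
        (𝒢.arithmeticSubgroup_le_quotientSubgroup γ.2)⟩) =
      fun a => ∑' γ : 𝒢.arithmeticSubgroup, F (e.symm (a, γ)) := rfl
  rw [h2, ← h1, hρ'π, lintegral_smul_measure, hπ, lintegral_prod _ hG.aemeasurable]
  congr 1
  refine lintegral_congr fun a => ?_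
  rw [lintegral_count]

end General

/-! ### The case `G = D^×` -/

section Units

universe v

variable (K : Type) [Field K] [NumberField K] (D : Type v) [Ring D] [Algebra K D]
  [Module.Finite K D] [Nontrivial D]

omit [Nontrivial D] in
/-- `Dˣ` (embedded in `D_𝔸ˣ`) is countable (`D` is countable). [folklore] -/
theorem countable_arithmeticSubgroup_units :
    Countable (AdelicGroupData.units K D).arithmeticSubgroup := by
  haveI : Countable D := countable_of_module_finite K D
  haveI : Countable Dˣ := (Units.val_injective : Function.Injective (Units.val : Dˣ → D)).countable
  haveI : Countable (AdelicGroupData.units K D).Rational := ‹Countable Dˣ›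
  change Countable (Set.range (AdelicGroupData.units K D).toAdelic)
  exact (Set.countable_range _).to_subtype

/-- **The Haar measure of `ℝ_{>0} · Dˣ` is `κ · (dα ⊗ counting)`**: for a finite-dimensional
`K`-algebra `D ≠ 0` over a number field, any Borel structure on `D_𝔸ˣ`, a Haar measure `ρ` on the
closed subgroup `ℝ_{>0} · Dˣ ≤ D_𝔸ˣ` and a Haar measure `α` on its central factor `ℝ_{>0}`
(`posRealCentral`), there is `κ > 0` with
`∫_{ℝ_{>0} · Dˣ} F dρ = κ ∫_{ℝ_{>0}} ∑_{γ ∈ Dˣ} F(a γ) dα(a)` for every measurable `F ≥ 0`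
(`exists_lintegral_quotientSubgroup_eq_mul_lintegral_tsum` with the central retraction of
`exists_centralRetraction_units` and the discreteness `units_isDiscreteRational_holds`). This is the
shape `∫_{A_G} Σ_γ` of the kernel `K_Φ(x, x)` on the `D^×` side of Gelbart's (10.14).
[cite: WeilBNT1967, Ch. IV §4 Cor. 2 of Thm. 5] -/
theorem exists_lintegral_quotientSubgroup_units_eq_mul_lintegral_tsum
    [MeasurableSpace (AdelicGroupData.units K D).Adelic]
    [BorelSpace (AdelicGroupData.units K D).Adelic]
    (ρ : Measure (AdelicGroupData.units K D).quotientSubgroup) [ρ.IsHaarMeasure]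
    (α : Measure (AdelicGroupData.units K D).center') [α.IsHaarMeasure] :
    ∃ κ : ℝ≥0, 0 < κ ∧ ∀ F : (AdelicGroupData.units K D).quotientSubgroup → ℝ≥0∞, Measurable F →
      ∫⁻ h, F h ∂ρ = κ * ∫⁻ a, ∑' γ : (AdelicGroupData.units K D).arithmeticSubgroup,
        F ⟨(a : (AdelicGroupData.units K D).Adelic) * γ,
          mul_mem ((AdelicGroupData.units K D).center'_le_quotientSubgroup a.2)
            ((AdelicGroupData.units K D).arithmeticSubgroup_le_quotientSubgroup γ.2)⟩ ∂α := by
  haveI : LocallyCompactSpace (AdeleRing (𝓞 K) K) := locallyCompactSpace_adeleRing' K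
  haveI : T2Space (AdeleRing (𝓞 K) K) := t2Space_adeleRing K
  haveI i₁ : LocallyCompactSpace (adelicUnits K D) := inferInstance
  haveI i₂ : T2Space (adelicUnits K D) := t2Space_adelicUnits K D
  haveI i₃ : SecondCountableTopology (adelicUnits K D) := by
    haveI : SecondCountableTopology (AdeleRing (𝓞 K) K) := secondCountableTopology_adeleRing K
    haveI : SecondCountableTopology (ScalarExtension K (AdeleRing (𝓞 K) K) D) :=
      (ScalarExtension.coordHomeomorph K (AdeleRing (𝓞 K) K) D).secondCountableTopology
    haveI : SecondCountableTopology (ScalarExtension K (AdeleRing (𝓞 K) K) D)ᵐᵒᵖ :=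
      MulOpposite.opHomeomorph.symm.secondCountableTopology
    exact Units.isEmbedding_embedProduct.secondCountableTopology
  haveI : LocallyCompactSpace (AdelicGroupData.units K D).Adelic := i₁
  haveI : T2Space (AdelicGroupData.units K D).Adelic := i₂
  haveI : SecondCountableTopology (AdelicGroupData.units K D).Adelic := i₃
  haveI : Countable (AdelicGroupData.units K D).arithmeticSubgroup :=
    countable_arithmeticSubgroup_units K D
  obtain ⟨θ, hθc, hθA, hθa, hθγ⟩ := exists_centralRetraction_units K D
  exact exists_lintegral_quotientSubgroup_eq_mul_lintegral_tsum (AdelicGroupData.units K D) θ hθA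
    hθa hθγ (AdelicGroupData.units_isDiscreteRational_holds K D) hθc ρ α

end Units

end AdelicGroupData

end Literature.NumberTheory.Automorphic
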